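import Literature.AlgebraicGeometry.Resolution.KnafKuhlmann2009Thm11Parts
import Literature.AlgebraicGeometry.Resolution.ValuedFunctionFieldsLemmas
import Mathlib.FieldTheory.IsSepClosed
import Mathlib.FieldTheory.IsAlgClosed.Basic
import HarnessLib

/-!
# Knaf–Kuhlmann 2009, Lemma 2.1 (value group and residue field of `K^{sep}`) — PROVED

Topic: `Literature/AlgebraicGeometry/Resolution`. We DISCHARGE the named fact
`KnafKuhlmann2009_Lemma21` of `KnafKuhlmann2009Thm11Parts.lean`:

> **Knaf–Kuhlmann 2009, Lemma 2.1** (= F.-V. Kuhlmann, *Value groups, residue fields, and bad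
> places of rational function fields*, Trans. AMS 356 (2004), Lemma 2.16). "Let `K` be an
> arbitrary field and `P` a non-trivial place on `K^{sep}`. Then `v(K^{sep})` is the divisible
> hull `vK ⊗_ℤ ℚ` of `vK`, and `K^{sep}P` is the algebraic closure of `KP`."

(`KnafKuhlmann2009_Lemma21_holds`), one of the two valuation-theoretic facts on which the proof
of Knaf–Kuhlmann 2009, Thm. 1.1 (and through it Thm. 1.2, `KnafKuhlmann2009_Thm12`) rests in
this topic. The paper refers to [K4] for the proof; we give the standard one, in the ambient
rendering of the fact (`K ≤ L ≤ Ω`, `Ω` algebraically closed with valuation ring `V`, `L` the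
elements separable over `K`, so that `L` is separably closed):

* `exists_valuation_pow_eq_of_isSepClosed` — **`vK` is divisible in `vL`**: for `c ∈ Lˣ` and
  `n ≥ 1` there is `a ∈ L` with `v(aⁿ) = v(c)`. By induction on `n`: if `n ≠ 0` in `L`, take an
  `n`-th root of `c` in `L` (`X^n - c` is separable); otherwise `n = p·m` with `p = char L`, and
  `p`-th roots of VALUES exist by Artin–Schreier (`exists_valuation_pow_char_eq`: for `v(c) > 1`
  a root `ϑ ∈ L` of `X^p - X - c` has `v(ϑ) > 1`, hence `v(ϑ^p) = v(ϑ^p - ϑ) = v(c)`; for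
  `v(c) < 1` pass to `c⁻¹`).
* `exists_valuation_pow_eq_of_isAlgebraic` — **`vL/vK` is torsion**: if `∑ cᵢ aⁱ = 0` is a
  non-trivial relation over `K`, two summands have the same value (otherwise the value of the
  sum is that of the dominant summand, non-zero), whence `v(a^{j-i}) = v(cᵢ/cⱼ)`.
* `isAlgebraic_residue_of_isAlgebraic` — **`LP|KP` is algebraic**: normalise a relation by the
  coefficient of largest value and reduce it.
* `isAlgClosed_resField_of_isSepClosed` — **`LP` is algebraically closed** (here the
  non-triviality of the place is used). Monic polynomials over `LP` lift to monic polynomials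
  over `V ∩ L` (`Polynomial.lifts_and_degree_eq_and_monic` for the residue map `V ∩ L → LP`, `exists_resHom`), whose
  roots in `L` lie in `V` and reduce to roots (`exists_root_resField_of_separable`,
  `isAlgClosed_resField_of_isAlgClosed`). In characteristic `0`, `L` is algebraically closed
  and this suffices. In characteristic `p`: (a) `LP` is separably closed (`isSepClosed_resField`):
  for a separable reduction, a Bezout relation `A q̄ + B q̄' = 1` lifts to `A F + B F' = 1 + N`
  with `N` having coefficients in the maximal ideal, so a common root `α ∈ O_Ω` of `F, F'` in
  `Ω` would give `N(α) = -1` with `v(N(α)) < 1` — `F` is separable over `L` and has a root in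
  `L`; (b) `LP` is perfect (`perfectField_resField_of_charP`): for `c ∈ O ∩ L` and
  `0 ≠ π ∈ 𝔪 ∩ L`, a root `y ∈ L` of the separable `y^p - π y - c` lies in `O` and `ȳ^p = c̄`;
  (a) + (b) give algebraic closedness (Mathlib's `IsSepClosed.isAlgClosed_of_perfectField`).

## Source

* H. Knaf, F.-V. Kuhlmann, *Every place admits local uniformization in a finite extension of
  the function field*, Adv. Math. 221 (2009) 428–453 = arXiv:math/0702856, Lemma 2.1 (p. 7:
  "For a proof see [K4], Lemma 2.16").
* F.-V. Kuhlmann, *Value groups, residue fields, and bad places of rational function fields*,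
  Trans. Amer. Math. Soc. 356 (2004) 4559–4600, Lemma 2.16 (the paper's reference; the proof
  given here is the standard Kummer/Artin–Schreier argument and does not follow a printed text).
-/

noncomputable section

namespace Literature.AlgebraicGeometry.Resolution

universe u

open IsLocalRing

/-! ## Values of `K^{sep}`: the divisible hull of `vK` -/

section Divisible

variable {Ω : Type u} [Field Ω]

/-- **Artin–Schreier roots of values**: over a separable-algebraically closed subfield `L` of
characteristic `p > 0`, every value `v(c)`, `c ∈ Lˣ`, is the `p`-th power of a value of `L`
(for `v(c) > 1` a root `ϑ ∈ L` of `X^p - X - c` has `v(ϑ^p) = v(c)`). [folklore] -/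
theorem exists_valuation_pow_char_eq (V : ValuationSubring Ω) {L : Subfield Ω} [IsSepClosed L]
    {p : ℕ} (hp : p.Prime) [CharP L p] {c : Ω} (hcL : c ∈ L) (hc0 : c ≠ 0) :
    ∃ a ∈ L, V.valuation (a ^ p) = V.valuation c := by
  -- the case `v(d) > 1`
  have key : ∀ d : Ω, d ∈ L → 1 < V.valuation d →
      ∃ a ∈ L, V.valuation (a ^ p) = V.valuation d := by
    intro d hdL hd1
    have hpL : ((p : ℕ) : L) = 0 := CharP.cast_eq_zero L p
    obtain ⟨x, hx⟩ := IsSepClosed.exists_root_C_mul_X_pow_add_C_mul_X_add_C (k := L)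
      (1 : L) (-1 : L) (-⟨d, hdL⟩) hpL hp.two_le (by norm_num)
    -- `x ^ p - x = d` in `Ω`
    have hx' : (x : Ω) ^ p - x = d := by
      have h := congrArg (fun y : L => (y : Ω)) hx
      push_cast at h
      linear_combination h
    refine ⟨x, x.2, ?_⟩
    have hvx : 1 < V.valuation (x : Ω) := by
      by_contra hle
      push Not at hle
      have h1 : V.valuation ((x : Ω) ^ p - x) ≤ 1 := by
        refine le_trans (Valuation.map_sub _ _ _) (max_le ?_ hle)
        rw [map_pow]
        exact pow_le_one' hle p
      rw [hx'] at h1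
      exact absurd h1 (not_le.mpr hd1)
    have hlt : V.valuation (x : Ω) < V.valuation ((x : Ω) ^ p) := by
      rw [map_pow]
      conv_lhs => rw [← pow_one (V.valuation (x : Ω))]
      exact pow_lt_pow_right₀ hvx hp.one_lt
    rw [← hx', Valuation.map_sub_eq_of_lt_left _ hlt]
  rcases lt_trichotomy (V.valuation c) 1 with hlt | heq | hgt
  · -- `v(c) < 1`: use `c⁻¹`
    have hc1 : 1 < V.valuation c⁻¹ := by
      rw [map_inv₀]
      exact (one_lt_inv₀ (zero_lt_iff.mpr ((map_ne_zero V.valuation).mpr hc0))).mpr hlt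
    obtain ⟨a, haL, ha⟩ := key c⁻¹ (inv_mem hcL) hc1
    refine ⟨a⁻¹, inv_mem haL, ?_⟩
    rw [inv_pow, map_inv₀, ha, map_inv₀, inv_inv]
  · exact ⟨1, one_mem L, by rw [one_pow, map_one, heq]⟩
  · exact key c hcL hgt

/-- **`vK` is divisible in `v(K^{sep})`**: over a separable-algebraically closed subfield `L`,
every value `v(c)`, `c ∈ Lˣ`, has an `n`-th root among the values of `L`, for every `n ≥ 1`
(`n`-th roots for `n` prime to the characteristic, Artin–Schreier roots for the
characteristic). [folklore] -/
theorem exists_valuation_pow_eq_of_isSepClosed (V : ValuationSubring Ω) {L : Subfield Ω}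
    [IsSepClosed L] (n : ℕ) (hn : n ≠ 0) {c : Ω} (hcL : c ∈ L) (hc0 : c ≠ 0) :
    ∃ a ∈ L, V.valuation (a ^ n) = V.valuation c := by
  induction n using Nat.strong_induction_on generalizing c with
  | _ n ih =>
    by_cases hnL : ((n : ℕ) : L) = 0
    · -- the characteristic `p` of `L` is a prime dividing `n`
      set p := ringChar L with hpdef
      have hpn : p ∣ n := ringChar.dvd hnL
      have hp0 : p ≠ 0 := by
        rintro h0
        rw [h0, zero_dvd_iff] at hpn
        exact hn hpn
      haveI : CharP L p := ringChar.charP L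
      have hp : p.Prime := CharP.char_prime_of_ne_zero L hp0
      obtain ⟨m, rfl⟩ := hpn
      have hm0 : m ≠ 0 := fun h0 => hn (by rw [h0, mul_zero])
      have hmlt : m < p * m := lt_mul_left (Nat.pos_of_ne_zero hm0) hp.one_lt
      obtain ⟨a₁, ha₁L, ha₁⟩ := ih m hmlt hm0 hcL hc0
      have ha₁0 : a₁ ≠ 0 := by
        rintro rfl
        rw [zero_pow hm0, map_zero, eq_comm, map_eq_zero] at ha₁
        exact hc0 ha₁
      obtain ⟨a, haL, ha⟩ := exists_valuation_pow_char_eq V hp ha₁L ha₁0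
      refine ⟨a, haL, ?_⟩
      rw [pow_mul, map_pow, ha, ← map_pow, ha₁]
    · haveI : NeZero ((n : ℕ) : L) := ⟨hnL⟩
      obtain ⟨z, hz⟩ := IsSepClosed.exists_pow_nat_eq (⟨c, hcL⟩ : L) n
      refine ⟨z, z.2, ?_⟩
      have h := congrArg (fun y : L => (y : Ω)) hz
      push_cast at h
      rw [h]

end Divisible

/-! ## Values and residues of algebraic elements -/

section Algebraic

variable {Ω : Type u} [Field Ω]

/-- A polynomial relation over a subfield, summed over the support. [folklore] -/
theorem sum_support_eq_zero_of_aeval_eq_zero {K : Subfield Ω} {a : Ω} {p : Polynomial K}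
    (hpa : Polynomial.aeval a p = 0) :
    ∑ i ∈ p.support, algebraMap K Ω (p.coeff i) * a ^ i = 0 := by
  have hrange : ∑ i ∈ Finset.range (p.natDegree + 1), algebraMap K Ω (p.coeff i) * a ^ i = 0 := by
    have h := hpa
    rw [Polynomial.aeval_eq_sum_range] at h
    simpa only [Algebra.smul_def] using h
  rw [← hrange]
  refine Finset.sum_subset (fun i hi => Finset.mem_range_succ_iff.mpr
    (Polynomial.le_natDegree_of_mem_supp i hi)) fun i _ hi => ?_
  have : p.coeff i = 0 := Polynomial.notMem_support_iff.mp hi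
  simp [this]

/-- The value of a non-zero element algebraic over the subfield `K` is torsion modulo `vK`: in
a relation `∑ cᵢ aⁱ = 0` two summands have the same value. [folklore] -/
theorem exists_valuation_pow_eq_of_isAlgebraic (V : ValuationSubring Ω) {K : Subfield Ω} {a : Ω}
    (ha : IsAlgebraic K a) (ha0 : a ≠ 0) :
    ∃ n : ℕ, n ≠ 0 ∧ ∃ b ∈ K, V.valuation (a ^ n) = V.valuation b := by
  classical
  obtain ⟨p, hp0, hpa⟩ := ha
  set s := p.support with hsdef
  have hs : s.Nonempty := Polynomial.nonempty_support_iff.mpr hp0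
  have hinj : Function.Injective (algebraMap K Ω) := (algebraMap K Ω).injective
  let f : ℕ → Ω := fun i => algebraMap K Ω (p.coeff i) * a ^ i
  have hsum : ∑ i ∈ s, f i = 0 := sum_support_eq_zero_of_aeval_eq_zero hpa
  have hcoef : ∀ i ∈ s, algebraMap K Ω (p.coeff i) ≠ 0 := fun i hi =>
    (map_ne_zero_iff _ hinj).mpr (Polynomial.mem_support_iff.mp hi)
  have hf0 : ∀ i ∈ s, f i ≠ 0 := fun i hi => mul_ne_zero (hcoef i hi) (pow_ne_zero i ha0)
  -- two distinct indices with the same value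
  have hij : ∃ i ∈ s, ∃ j ∈ s, i ≠ j ∧ V.valuation (f i) = V.valuation (f j) := by
    by_contra hcon
    push Not at hcon
    obtain ⟨j, hj, hjmax⟩ := Finset.exists_max_image s (fun i => V.valuation (f i)) hs
    have hlt : ∀ i ∈ s \ {j}, V.valuation (f i) < V.valuation (f j) := by
      intro i hi
      rw [Finset.mem_sdiff, Finset.mem_singleton] at hi
      exact lt_of_le_of_ne (hjmax i hi.1) (hcon i hi.1 j hj hi.2)
    have hv := V.valuation.map_sum_eq_of_lt hj hlt
    rw [hsum, map_zero, eq_comm, map_eq_zero] at hv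
    exact hf0 j hj hv
  -- from `v(cᵢ aⁱ) = v(cⱼ aʲ)` with `i < j`: `v(a^(j-i)) = v(cᵢ/cⱼ)`
  have main : ∀ i ∈ s, ∀ j ∈ s, i < j → V.valuation (f i) = V.valuation (f j) →
      ∃ n : ℕ, n ≠ 0 ∧ ∃ b ∈ K, V.valuation (a ^ n) = V.valuation b := by
    intro i hi j hj hlt heq
    refine ⟨j - i, Nat.sub_ne_zero_of_lt hlt,
      algebraMap K Ω (p.coeff i) / algebraMap K Ω (p.coeff j),
      div_mem (p.coeff i).2 (p.coeff j).2, ?_⟩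
    have hva0 : V.valuation a ≠ 0 := (map_ne_zero V.valuation).mpr ha0
    have hvcj0 : V.valuation (algebraMap K Ω (p.coeff j)) ≠ 0 :=
      (map_ne_zero V.valuation).mpr (hcoef j hj)
    change V.valuation (algebraMap K Ω (p.coeff i) * a ^ i) =
      V.valuation (algebraMap K Ω (p.coeff j) * a ^ j) at heq
    rw [map_mul, map_mul, map_pow, map_pow] at heq
    have hpow : V.valuation a ^ j = V.valuation a ^ i * V.valuation a ^ (j - i) := by
      rw [← pow_add, Nat.add_sub_cancel' hlt.le]
    rw [hpow] at heq
    have h3 : V.valuation (algebraMap K Ω (p.coeff i)) =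
        V.valuation (algebraMap K Ω (p.coeff j)) * V.valuation a ^ (j - i) := by
      apply mul_right_cancel₀ (pow_ne_zero i hva0)
      rw [heq, mul_assoc, mul_comm (V.valuation a ^ i)]
    rw [map_pow, map_div₀, eq_div_iff hvcj0, mul_comm]
    exact h3.symm
  obtain ⟨i, hi, j, hj, hne, heq⟩ := hij
  rcases Nat.lt_or_gt_of_ne hne with h | h
  · exact main i hi j hj h heq
  · exact main j hj i hi h heq.symm

/-- The residue of an element of `V` algebraic over the subfield `K` is algebraic over the
residue field `KP`: normalise a relation `∑ cᵢ aⁱ = 0` by the coefficient of largest value and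
reduce. [folklore] -/
theorem isAlgebraic_residue_of_isAlgebraic (V : ValuationSubring Ω) {K : Subfield Ω} {a : Ω}
    (haV : a ∈ V) (ha : IsAlgebraic K a) :
    IsAlgebraic (resField V K) (residue V ⟨a, haV⟩) := by
  classical
  obtain ⟨p, hp0, hpa⟩ := ha
  set s := p.support with hsdef
  have hs : s.Nonempty := Polynomial.nonempty_support_iff.mpr hp0
  have hinj : Function.Injective (algebraMap K Ω) := (algebraMap K Ω).injective
  obtain ⟨j, hj, hjmax⟩ :=
    Finset.exists_max_image s (fun i => V.valuation (algebraMap K Ω (p.coeff i))) hs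
  set c : Ω := algebraMap K Ω (p.coeff j) with hcdef
  have hcK : c ∈ K := (p.coeff j).2
  have hc0 : c ≠ 0 := (map_ne_zero_iff _ hinj).mpr (Polynomial.mem_support_iff.mp hj)
  have hvc0 : V.valuation c ≠ 0 := (map_ne_zero V.valuation).mpr hc0
  -- the normalised coefficients `dᵢ := cᵢ / c ∈ V ∩ K`
  have hdV : ∀ i, algebraMap K Ω (p.coeff i) / c ∈ V := by
    intro i
    by_cases hi : i ∈ s
    · rw [← V.valuation_le_one_iff, map_div₀, div_le_one₀ (zero_lt_iff.mpr hvc0)]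
      exact hjmax i hi
    · have : p.coeff i = 0 := Polynomial.notMem_support_iff.mp hi
      simp [this, V.zero_mem]
  have hdK : ∀ i, algebraMap K Ω (p.coeff i) / c ∈ K := fun i => div_mem (p.coeff i).2 hcK
  let dV : ℕ → V := fun i => ⟨algebraMap K Ω (p.coeff i) / c, hdV i⟩
  let aV : V := ⟨a, haV⟩
  let d : ℕ → resField V K := fun i => ⟨residue V (dV i), residue_mem_resField V _ (hdK i)⟩
  let q : Polynomial (resField V K) := ∑ i ∈ s, Polynomial.C (d i) * Polynomial.X ^ i
  have hqj : q.coeff j = 1 := by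
    simp only [q, Polynomial.finsetSum_coeff, Polynomial.coeff_C_mul_X_pow]
    rw [Finset.sum_eq_single j]
    · rw [if_pos rfl]
      apply Subtype.ext
      change residue V (dV j) = ((1 : resField V K) : ResidueField V)
      have h1 : dV j = 1 := Subtype.ext (div_self hc0)
      rw [h1, map_one]
      rfl
    · intro i _ hij
      rw [if_neg (Ne.symm hij)]
    · intro hjs
      exact absurd hj hjs
  have hq0 : q ≠ 0 := fun h0 => by
    have := congrArg (fun r => Polynomial.coeff r j) h0
    simp only [hqj, Polynomial.coeff_zero] at this
    exact one_ne_zero this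
  refine ⟨q, hq0, ?_⟩
  -- `∑ dᵢ aⁱ = (1/c) ∑ cᵢ aⁱ = 0` in `V`, then reduce
  have hsum : ∑ i ∈ s, algebraMap K Ω (p.coeff i) * a ^ i = 0 :=
    sum_support_eq_zero_of_aeval_eq_zero hpa
  have hS : V.subtype (∑ i ∈ s, dV i * aV ^ i) =
      c⁻¹ * ∑ i ∈ s, algebraMap K Ω (p.coeff i) * a ^ i := by
    rw [map_sum, Finset.mul_sum]
    refine Finset.sum_congr rfl fun i _ => ?_
    rw [map_mul, map_pow]
    change algebraMap K Ω (p.coeff i) / c * a ^ i = c⁻¹ * (algebraMap K Ω (p.coeff i) * a ^ i)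
    ring
  have hsumV : ∑ i ∈ s, dV i * aV ^ i = 0 := by
    apply Subtype.coe_injective
    change V.subtype (∑ i ∈ s, dV i * aV ^ i) = ((0 : V) : Ω)
    rw [hS, hsum, mul_zero]
    rfl
  have hres := congrArg (residue V) hsumV
  rw [map_sum, map_zero] at hres
  simp only [map_mul, map_pow] at hres
  simp only [q, map_sum, map_mul, map_pow, Polynomial.aeval_C, Polynomial.aeval_X]
  exact hres

end Algebraic

/-! ## The residue field of `K^{sep}` is algebraically closed -/

section ResField

variable {Ω : Type u} [Field Ω]

/-- **The residue map `V ∩ L → LP`** onto the residue field of the subfield `L`: a surjective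
ring homomorphism `ρ` with `ρ(r) = rP`, and `ρ(r) = 0` iff `v(r) < 1`. [folklore] -/
theorem exists_resHom (V : ValuationSubring Ω) (L : Subfield Ω) :
    ∃ ρ : ↥(V.toSubring ⊓ L.toSubring) →+* resField V L, Function.Surjective ρ ∧
      (∀ r, (ρ r : ResidueField V) = residue V ⟨(r : Ω), r.2.1⟩) ∧
      ∀ r, ρ r = 0 ↔ V.valuation (r : Ω) < 1 := by
  let ρ : ↥(V.toSubring ⊓ L.toSubring) →+* resField V L :=
    { toFun := fun r => ⟨residue V ⟨(r : Ω), r.2.1⟩, residue_mem_resField V ⟨(r : Ω), r.2.1⟩ r.2.2⟩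
      map_one' := Subtype.ext (by
        change residue V ⟨((1 : ↥(V.toSubring ⊓ L.toSubring)) : Ω), _⟩ = 1
        rw [← map_one (residue V)]; rfl)
      map_mul' := fun a b => Subtype.ext (by
        change residue V ⟨(a : Ω) * b, _⟩ = residue V ⟨a, _⟩ * residue V ⟨b, _⟩
        rw [← map_mul]; rfl)
      map_zero' := Subtype.ext (by
        change residue V ⟨((0 : ↥(V.toSubring ⊓ L.toSubring)) : Ω), _⟩ = 0
        rw [← map_zero (residue V)]; rfl)
      map_add' := fun a b => Subtype.ext (by
        change residue V ⟨(a : Ω) + b, _⟩ = residue V ⟨a, _⟩ + residue V ⟨b, _⟩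
        rw [← map_add]; rfl) }
  have hρ : ∀ r, (ρ r : ResidueField V) = residue V ⟨(r : Ω), r.2.1⟩ := fun r => rfl
  refine ⟨ρ, fun r => ?_, hρ, fun r => ?_⟩
  · obtain ⟨a, haL, har⟩ := (mem_resField_iff V L r).mp r.2
    exact ⟨⟨(a : Ω), a.2, haL⟩, Subtype.ext har⟩
  · rw [← ValuationSubring.valuation_lt_one_iff V ⟨(r : Ω), r.2.1⟩, ← residue_eq_zero_iff, ← hρ]
    constructor
    · intro h
      exact congrArg Subtype.val h
    · intro h
      exact Subtype.ext h

/-- Roots of a monic polynomial with coefficients in `V` lie in `V`. [folklore] -/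
theorem mem_of_aeval_monic_eq_zero (V : ValuationSubring Ω) (L : Subfield Ω)
    {F : Polynomial ↥(V.toSubring ⊓ L.toSubring)} (hF : F.Monic) {α : Ω}
    (hα : Polynomial.aeval α F = 0) : α ∈ V :=
  mem_of_isIntegral_of_le (V := V) (S := V.toSubring ⊓ L.toSubring) inf_le_left
    ⟨F, hF, by rwa [← Polynomial.aeval_def]⟩

/-- **Lifting roots of separable reductions.** For a separable-algebraically closed subfield `L`
of the algebraically closed valued field `(Ω, V)`: a monic polynomial over the residue field
`LP` which is separable and of positive degree has a root in `LP` (lift it to a monic `F` over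
`V ∩ L`; a Bezout relation for the reduction lifts to `A F + B F' = 1 + N`, `N` with
coefficients in the maximal ideal, so `F` has no multiple root in `O_Ω ⊇` the roots of `F`, i.e.
`F` is separable over `L`, hence has a root in `L`, which lies in `V` and reduces to a root).
[folklore] -/
theorem exists_root_resField_of_separable [IsAlgClosed Ω] (V : ValuationSubring Ω) (L : Subfield Ω)
    [IsSepClosed L] (q : Polynomial (resField V L)) (hqm : q.Monic) (hq0 : q.degree ≠ 0)
    (hsep : q.Separable) : ∃ r : resField V L, q.eval r = 0 := by
  classical
  set R : Subring Ω := V.toSubring ⊓ L.toSubring with hRdef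
  obtain ⟨ρ, hρ, hρapply, hρzero⟩ := exists_resHom V L
  let ι : ↥R →+* L := Subring.inclusion (inf_le_right : V.toSubring ⊓ L.toSubring ≤ L.toSubring)
  have hιinj : Function.Injective ι := Subring.inclusion_injective _
  letI : Algebra R L := ι.toAlgebra
  haveI : IsScalarTower R L Ω := IsScalarTower.of_algebraMap_eq fun _ => rfl
  -- lift `q` to a monic `F` over `R = V ∩ L`
  obtain ⟨F, hFq, hFdeg, hFm⟩ := Polynomial.lifts_and_degree_eq_and_monic
    (Polynomial.mem_lifts_of_surjective hρ q) hqm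
  -- `f := F` over `L` is separable
  let f : Polynomial L := F.map (algebraMap R L)
  have hfm : f.Monic := hFm.map _
  have hιinj' : Function.Injective (algebraMap R L) := hιinj
  have hfdeg : f.degree ≠ 0 := by
    change (F.map (algebraMap R L)).degree ≠ 0
    rw [Polynomial.degree_map_eq_of_injective hιinj', hFdeg]
    exact hq0
  have hfsep : f.Separable := by
    rw [Polynomial.separable_def,
      Polynomial.isCoprime_iff_aeval_ne_zero_of_isAlgClosed L Ω f (Polynomial.derivative f)]
    intro α
    by_contra hcon
    push Not at hcon
    obtain ⟨hfa, hf'a⟩ := hcon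
    have hFa : Polynomial.aeval α F = 0 := by
      rwa [Polynomial.aeval_map_algebraMap] at hfa
    have hF'a : Polynomial.aeval α (Polynomial.derivative F) = 0 := by
      rwa [Polynomial.derivative_map, Polynomial.aeval_map_algebraMap] at hf'a
    have hαV : α ∈ V := mem_of_aeval_monic_eq_zero V L hFm hFa
    -- Bezout for the reduction, lifted
    obtain ⟨A, B, hAB⟩ := hsep
    obtain ⟨A', hA'⟩ := Polynomial.map_surjective ρ hρ A
    obtain ⟨B', hB'⟩ := Polynomial.map_surjective ρ hρ B
    set N : Polynomial R := A' * F + B' * Polynomial.derivative F - 1 with hNdef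
    have hN : N.map ρ = 0 := by
      rw [hNdef, Polynomial.map_sub, Polynomial.map_add, Polynomial.map_mul, Polynomial.map_mul,
        ← Polynomial.derivative_map, hA', hB', hFq, Polynomial.map_one, hAB, sub_self]
    have hNcoeff : ∀ i, V.valuation ((N.coeff i : R) : Ω) < 1 := by
      intro i
      rw [← hρzero]
      have := congrArg (fun P => Polynomial.coeff P i) hN
      simpa only [Polynomial.coeff_map, Polynomial.coeff_zero] using this
    -- evaluate at `α`: `N(α) = -1` but `v(N(α)) < 1`
    have hNa : Polynomial.aeval α N = -1 := by
      rw [hNdef, map_sub, map_add, map_mul, map_mul, hFa, hF'a, map_one]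
      ring
    have hvNa : V.valuation (Polynomial.aeval α N) < 1 := by
      rw [Polynomial.aeval_eq_sum_range]
      refine V.valuation.map_sum_lt one_ne_zero fun i _ => ?_
      rw [Algebra.smul_def, map_mul, map_pow]
      have h1 : V.valuation (algebraMap R Ω (N.coeff i)) < 1 := hNcoeff i
      have h2 : V.valuation α ^ i ≤ 1 := pow_le_one' ((V.valuation_le_one_iff α).mpr hαV) i
      exact lt_of_le_of_lt (mul_le_of_le_one_right' h2) h1
    rw [hNa, Valuation.map_neg, map_one] at hvNa
    exact lt_irrefl _ hvNa
  -- a root `x ∈ L` of `f`; it lies in `V` and reduces to a root of `q`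
  obtain ⟨x, hx⟩ := IsSepClosed.exists_root f hfdeg hfsep
  have hx0 : Polynomial.eval x f = 0 := hx
  have hxa : Polynomial.aeval (x : Ω) F = 0 := by
    have h : Polynomial.aeval (x : Ω) f = 0 := by
      rw [show (x : Ω) = algebraMap L Ω x from rfl,
        Polynomial.aeval_algebraMap_apply_eq_algebraMap_eval]
      change algebraMap L Ω (Polynomial.eval x f) = 0
      rw [hx0, map_zero]
    rwa [Polynomial.aeval_map_algebraMap] at h
  have hxV : (x : Ω) ∈ V := mem_of_aeval_monic_eq_zero V L hFm hxa
  let xR : R := ⟨(x : Ω), hxV, x.2⟩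
  refine ⟨ρ xR, ?_⟩
  have hxR : Polynomial.eval xR F = 0 := by
    apply hιinj
    rw [map_zero, ← Polynomial.eval₂_hom, ← Polynomial.eval_map]
    exact hx0
  rw [← hFq, Polynomial.eval_map, Polynomial.eval₂_hom, hxR, map_zero]

/-- **`K^{sep}P` is separably closed** (for `(Ω, V)` algebraically closed and `L ≤ Ω`
separable-algebraically closed). [folklore] -/
theorem isSepClosed_resField [IsAlgClosed Ω] (V : ValuationSubring Ω) (L : Subfield Ω)
    [IsSepClosed L] : IsSepClosed (resField V L) :=
  IsSepClosed.of_exists_root _ fun q hqm hirr hsep =>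
    exists_root_resField_of_separable V L q hqm (Polynomial.degree_pos_of_irreducible hirr).ne' hsep

/-- If `L` is even algebraically closed (e.g. in characteristic `0`), `LP` is algebraically closed:
lift a monic polynomial, take a root in `L`, reduce. [folklore] -/
theorem isAlgClosed_resField_of_isAlgClosed (V : ValuationSubring Ω) (L : Subfield Ω)
    [IsAlgClosed L] : IsAlgClosed (resField V L) := by
  classical
  refine IsAlgClosed.of_exists_root _ fun q hqm hirr => ?_
  set R : Subring Ω := V.toSubring ⊓ L.toSubring with hRdef
  obtain ⟨ρ, hρ, hρapply, hρzero⟩ := exists_resHom V L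
  let ι : ↥R →+* L := Subring.inclusion (inf_le_right : V.toSubring ⊓ L.toSubring ≤ L.toSubring)
  have hιinj : Function.Injective ι := Subring.inclusion_injective _
  letI : Algebra R L := ι.toAlgebra
  haveI : IsScalarTower R L Ω := IsScalarTower.of_algebraMap_eq fun _ => rfl
  obtain ⟨F, hFq, hFdeg, hFm⟩ := Polynomial.lifts_and_degree_eq_and_monic
    (Polynomial.mem_lifts_of_surjective hρ q) hqm
  let f : Polynomial L := F.map (algebraMap R L)
  have hιinj' : Function.Injective (algebraMap R L) := hιinj
  have hfdeg : f.degree ≠ 0 := by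
    change (F.map (algebraMap R L)).degree ≠ 0
    rw [Polynomial.degree_map_eq_of_injective hιinj', hFdeg]
    exact (Polynomial.degree_pos_of_irreducible hirr).ne'
  obtain ⟨x, hx⟩ := IsAlgClosed.exists_root f hfdeg
  have hx0 : Polynomial.eval x f = 0 := hx
  have hxa : Polynomial.aeval (x : Ω) F = 0 := by
    have h : Polynomial.aeval (x : Ω) f = 0 := by
      rw [show (x : Ω) = algebraMap L Ω x from rfl,
        Polynomial.aeval_algebraMap_apply_eq_algebraMap_eval]
      change algebraMap L Ω (Polynomial.eval x f) = 0
      rw [hx0, map_zero]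
    rwa [Polynomial.aeval_map_algebraMap] at h
  have hxV : (x : Ω) ∈ V := mem_of_aeval_monic_eq_zero V L hFm hxa
  let xR : R := ⟨(x : Ω), hxV, x.2⟩
  refine ⟨ρ xR, ?_⟩
  have hxR : Polynomial.eval xR F = 0 := by
    apply hιinj
    rw [map_zero, ← Polynomial.eval₂_hom, ← Polynomial.eval_map]
    exact hx0
  rw [← hFq, Polynomial.eval_map, Polynomial.eval₂_hom, hxR, map_zero]

end ResField

/-! ## Perfectness of `K^{sep}P` in positive characteristic; the named fact -/

section Final

variable {Ω : Type u} [Field Ω]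

/-- **`K^{sep}P` is perfect** (positive residue characteristic, non-trivial valuation): for
`c ∈ O ∩ L` and `π ∈ 𝔪 ∩ L ∖ {0}` a root `y ∈ L` of the separable polynomial `y^p - π y - c`
lies in `O` and `ȳ^p = c̄` (Artin–Schreier). [folklore] -/
theorem perfectField_resField_of_charP (V : ValuationSubring Ω) (L : Subfield Ω) [IsSepClosed L]
    {p : ℕ} (hp : p.Prime) [CharP Ω p] (hL : ∃ a ∈ L, a ∉ V) : PerfectField (resField V L) := by
  -- characteristic bookkeeping
  have hpΩ : ((p : ℕ) : Ω) = 0 := CharP.cast_eq_zero Ω p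
  have hpL : ((p : ℕ) : L) = 0 := Subtype.ext (by push_cast; exact hpΩ)
  haveI : CharP L p := (CharP.charP_iff_prime_eq_zero hp).mpr hpL
  have hpV : ((p : ℕ) : V) = 0 := Subtype.ext (by push_cast; exact hpΩ)
  have hpk : ((p : ℕ) : resField V L) = 0 := by
    apply Subtype.ext
    push_cast
    rw [← map_natCast (residue V), hpV, map_zero]
  haveI : CharP (resField V L) p := (CharP.charP_iff_prime_eq_zero hp).mpr hpk
  haveI : ExpChar (resField V L) p := ExpChar.prime hp
  -- a non-zero element `π ∈ 𝔪 ∩ L`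
  obtain ⟨a, haL, haV⟩ := hL
  have ha1 : 1 < V.valuation a := lt_of_not_ge fun h => haV ((V.valuation_le_one_iff a).mp h)
  have ha0 : a ≠ 0 := by rintro rfl; exact haV V.zero_mem
  set π : Ω := a⁻¹ with hπdef
  have hπL : π ∈ L := inv_mem haL
  have hπ1 : V.valuation π < 1 := by
    rw [hπdef, map_inv₀]
    exact inv_lt_one_of_one_lt₀ ha1
  have hπ0 : π ≠ 0 := inv_ne_zero ha0
  have hπV : π ∈ V := (V.valuation_le_one_iff π).mp hπ1.le
  -- Frobenius is surjective on `LP`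
  have hsurj : Function.Surjective (frobenius (resField V L) p) := by
    intro s
    obtain ⟨c, hcL, hcs⟩ := (mem_resField_iff V L s).mp s.2
    have hπL0 : (-(⟨π, hπL⟩ : L)) ≠ 0 := by
      rw [neg_ne_zero]
      exact fun h => hπ0 (congrArg Subtype.val h)
    obtain ⟨y, hy⟩ := IsSepClosed.exists_root_C_mul_X_pow_add_C_mul_X_add_C (k := L)
      (1 : L) (-⟨π, hπL⟩) (-⟨(c : Ω), hcL⟩) hpL hp.two_le hπL0
    have hy' : (y : Ω) ^ p = π * y + c := by
      have h := congrArg (fun z : L => (z : Ω)) hy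
      push_cast at h
      linear_combination h
    -- `y ∈ V`
    have hyV : (y : Ω) ∈ V := by
      by_contra hyV
      have hy1 : 1 < V.valuation (y : Ω) :=
        lt_of_not_ge fun h => hyV ((V.valuation_le_one_iff _).mp h)
      have hlt : V.valuation (π * y + c) < V.valuation ((y : Ω) ^ p) := by
        have hyy : V.valuation (y : Ω) < V.valuation ((y : Ω) ^ p) := by
          rw [map_pow]
          conv_lhs => rw [← pow_one (V.valuation (y : Ω))]
          exact pow_lt_pow_right₀ hy1 hp.one_lt
        refine lt_of_le_of_lt (Valuation.map_add _ _ _) (max_lt ?_ ?_)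
        · rw [map_mul]
          exact lt_of_le_of_lt (mul_le_of_le_one_left' hπ1.le) hyy
        · exact lt_of_le_of_lt ((V.valuation_le_one_iff _).mpr c.2) (lt_trans hy1 hyy)
      rw [hy'] at hlt
      exact lt_irrefl _ hlt
    refine ⟨⟨residue V ⟨y, hyV⟩, residue_mem_resField V ⟨y, hyV⟩ y.2⟩, Subtype.ext ?_⟩
    rw [frobenius_def]
    change residue V ⟨y, hyV⟩ ^ p = (s : ResidueField V)
    rw [← hcs, ← map_pow]
    have hyp : (⟨(y : Ω), hyV⟩ : V) ^ p = ⟨π, hπV⟩ * ⟨y, hyV⟩ + c := Subtype.ext (by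
      push_cast
      exact hy')
    rw [hyp, map_add, map_mul]
    have hπ0' : residue V ⟨π, hπV⟩ = 0 :=
      (residue_eq_zero_iff _).mpr ((ValuationSubring.valuation_lt_one_iff V _).mpr hπ1)
    rw [hπ0', zero_mul, zero_add]
  haveI : PerfectRing (resField V L) p := PerfectRing.ofSurjective _ p hsurj
  exact PerfectRing.toPerfectField (resField V L) p

/-- **`K^{sep}P` is algebraically closed** for a non-trivially valued separable-algebraically
closed subfield `L` of the algebraically closed `(Ω, V)`: in characteristic `0`, `L` is
algebraically closed and roots lift-and-reduce; in characteristic `p`, `LP` is separably closed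
(`isSepClosed_resField`) and perfect (`perfectField_resField_of_charP`). [folklore] -/
theorem isAlgClosed_resField_of_isSepClosed [IsAlgClosed Ω] (V : ValuationSubring Ω)
    (L : Subfield Ω) [IsSepClosed L] (hL : ∃ a ∈ L, a ∉ V) : IsAlgClosed (resField V L) := by
  obtain ⟨p, hchar⟩ := ExpChar.exists Ω
  rcases hchar with _ | ⟨hprime⟩
  · haveI : CharZero L := SubsemiringClass.instCharZero L
    haveI : IsAlgClosed L := IsSepClosed.isAlgClosed_of_perfectField L
    exact isAlgClosed_resField_of_isAlgClosed V L
  · haveI : IsSepClosed (resField V L) := isSepClosed_resField V L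
    haveI : PerfectField (resField V L) := perfectField_resField_of_charP V L hprime hL
    exact IsSepClosed.isAlgClosed_of_perfectField _

/-- **Knaf–Kuhlmann 2009, Lemma 2.1** (= F.-V. Kuhlmann, *Value groups, residue fields, and bad
places of rational function fields*, Lemma 2.16) — PROVED: the named fact
`KnafKuhlmann2009_Lemma21` of `KnafKuhlmann2009Thm11Parts.lean` holds: for a non-trivial place on
`K^{sep}`, `v(K^{sep})` is the divisible hull of `vK` (`n`-th roots of values by Kummer and
Artin–Schreier equations, `exists_valuation_pow_eq_of_isSepClosed`; torsion by
`exists_valuation_pow_eq_of_isAlgebraic`) and `K^{sep}P` is the algebraic closure of `KP`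
(algebraic: `isAlgebraic_residue_of_isAlgebraic`; algebraically closed:
`isAlgClosed_resField_of_isSepClosed`). [cite: KnafKuhlmann2009, Lemma 2.1] -/
theorem KnafKuhlmann2009_Lemma21_holds : KnafKuhlmann2009_Lemma21.{u} := by
  intro Ω _ _ V K L hL hnt
  -- `L` is the separable closure of `K` in `Ω`, hence separably closed
  have hLeq : L = (separableClosure K Ω).toSubfield := by
    ext x
    exact (hL x).trans (mem_separableClosure_iff (F := K) (E := Ω) (x := x)).symm
  haveI : IsSepClosed L := by
    rw [hLeq]
    haveI : IsSepClosure K (separableClosure K Ω) := separableClosure.isSepClosure _ _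
    have h : IsSepClosed (separableClosure K Ω) := IsSepClosure.sep_closed K
    exact h
  have halgL : ∀ a ∈ L, IsAlgebraic K a := fun a ha => ((hL a).mp ha).isIntegral.isAlgebraic
  refine ⟨fun b hbK hb0 n hn => ?_, fun a haL ha0 => ?_, fun r hr => ?_, ?_⟩
  · have hbL : b ∈ L := (hL b).mpr (isSeparable_algebraMap (⟨b, hbK⟩ : K))
    exact exists_valuation_pow_eq_of_isSepClosed V n hn hbL hb0
  · exact exists_valuation_pow_eq_of_isAlgebraic V (halgL a haL) ha0
  · obtain ⟨a, haL, rfl⟩ := (mem_resField_iff V L r).mp hr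
    exact isAlgebraic_residue_of_isAlgebraic V a.2 (halgL a haL)
  · exact isAlgClosed_resField_of_isSepClosed V L hnt

end Final

end Literature.AlgebraicGeometry.Resolution

end
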